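import Summits.Ventures.PercRepro0.HighD
import Summits.Ventures.PercRepro0.Events
import Summits.Ventures.PercRepro0.Invariance
import Summits.Ventures.PercRepro0.Harris

/-!
# Block H closed modulo H1 and P3 (seat p3)

`HighD.THD_of_chain` (proofs/HIGHD-p3-v3.md §4) takes the route's named inputs H1, P3, P7, F1, F2 as
hypotheses.  Three of them are now kernel-checked on the cell's definitions and are discharged here:

* P7 (`Harris.P7_FKG_holds`, Harris–FKG in infinite volume),
* F1 (`Defs.measurableSet_atMostOneInfCluster`, `Defs.measurableSet_connInf`, p5's `Events.lean`),
* F2 (`Defs.P_connInf_eq_thetaI`, p5's `Invariance.lean`, rewritten as `P_connInf_eq_percolates`).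

What remains: `THD_of_H1_P3 : H1_Triangle11 → (∀ d, P3_Unique d) → THD` — H1 is the published
input (Fitzner–van der Hofstad 2017, Corollary 1.3; a print stays a hypothesis) and P3 is
Burton–Keane uniqueness (proofs/UNIQUENESS-p6-v1.md; Lean twin in progress by p6).  Also the
`d`-unrestricted forms `thetaI_sq_le_tau_of_P3` (H4) and `T_of_triangle_of_P3` (R_MID-3).
-/

namespace Summit.Ventures.PercRepro0.HighD

open MeasureTheory ProbabilityTheory unitInterval Defs
open scoped ENNReal

/-- F2(c) in the form `THD_of_chain` consumes: `P_p{x ↔ ∞} = P_p{0 ↔ ∞}` as measures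
(from `Invariance.P_connInf_eq_thetaI`, an identity of real numbers). -/
theorem P_connInf_eq_percolates (d : ℕ) (p : I) (x : Vertex d) :
    P d p {ω | ConnInf d ω x} = P d p (percolates d) := by
  have h := P_connInf_eq_thetaI p x
  unfold thetaI at h
  exact (ENNReal.toReal_eq_toReal_iff' (measure_ne_top _ _) (measure_ne_top _ _)).1 h

/-- H4 · THETA-SQUARED with P7, F1, F2 discharged: `θ_d(p)² ≤ τ_p(0,x)` from P3 at `p` alone. -/
theorem thetaI_sq_le_tau_of_P3 (d : ℕ) (p : I) (x : Vertex d) (hP3 : P3_Unique d) :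
    thetaI d p ^ 2 ≤ tau d p 0 x :=
  thetaI_sq_le_tau d p x hP3 (Harris.P7_FKG_holds d) measurableSet_atMostOneInfCluster
    (fun y => measurableSet_connInf y) (P_connInf_eq_percolates d p x)

/-- R_MID-3 (H2 + H3) with P7, F1, F2 discharged: for `d ≥ 1`, the triangle condition at `p_c(d)`
together with P3 forces `T d`. -/
theorem T_of_triangle_of_P3 (d : ℕ) (hd : 1 ≤ d) (hTri : TriangleCondition d (clamp (pc d)))
    (hP3 : P3_Unique d) : T d :=
  T_of_triangle d hd hTri hP3 (Harris.P7_FKG_holds d) measurableSet_atMostOneInfCluster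
    (fun y => measurableSet_connInf y) (fun x => P_connInf_eq_percolates d _ x)

/-- T_HD ⟸ H1 ∧ P3: the chain of HIGHD-p3-v3 §4 with P7, F1 and F2 kernel-checked; the two
remaining hypotheses are the published H1 and Burton–Keane uniqueness P3. -/
theorem THD_of_H1_P3 (hH1 : H1_Triangle11) (hP3 : ∀ d, P3_Unique d) : THD :=
  THD_of_chain hH1 hP3 Harris.P7_FKG_holds (fun _ => measurableSet_atMostOneInfCluster)
    (fun _ y => measurableSet_connInf y) (fun d p x => P_connInf_eq_percolates d p x)

end Summit.Ventures.PercRepro0.HighD
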